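/-
Copyright (c) 2026 the pub-hodgecm-mathlib formalisation cell (harness21).  Prover seat hodgecm-mathlib-F0P3a-p02 (g18): road «S3-ram», (Cnt2′) ROUTE B (chair
F0P3a-p07 (g15) RULING (17)(a)(b)): the FINITE half of the type-(2) root collar census, III — plane sums for a NON-centred block; 2026-09-02.
-/
import Literature.NumberTheory.Rogawski1990.DepthZeroKappaTransferTypeTwoRamifiedBlockRootPlaneSums   -- ★ p849328 (this seat): lines, bookkeeping, (I3)
import Literature.FieldTheory.FiniteFields.ConicCharacterSumTransferAffine                          -- p849406 (this seat): `quadraticChar_quartic_transfer_affine`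
import HarnessLib

/-!
# The type-(2) root census, III: plane character sums for a GENERAL (non-centred) self-adjoint residual block (Rogawski 1990 §4.9; Kottwitz 1986 §3;
# Lidl–Niederreiter Ch. 5 §4, Ch. 6 §2)

Topic `NumberTheory/Rogawski1990`; namespace `Literature.NumberTheory.Rogawski1990.TypeTwoBlockRoot` (continues ★ `…BlockRootPlaneSums`).  THEOREMS ONLY (no definition,
no instance, no notation, no named fact, no `sorry`); kernel lane `--supports stmt-HodgeConjecture-24833` (cell `pub/hodgecm-mathlib`, crux H413, road «S3-ram»,
count-neutral).  Statement-first v2 `F0/P3a/F0P3a-p02/g18/census/BlockRootCensus.statementfirst.v2.F0P3ap02g18.lean`; chair F0P3a-p07 (g15) RULING (17)(a)(b)(v): the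
residual W-block of a type-(2) root need NOT be centred against the isolated eigenvalue, and the census depends on its relative scalar part.

THE MATHEMATICS (`k` finite, odd characteristic).  Root-plane norm `n(X,Y) = δ₁X² + δ₂Y²`; cone value now the GENERAL binary form `T(X,Y) = δ₁αX² + 2δ₁bXY + δ₂γY²` of an
`n`-self-adjoint block `((α, b), (b', γ))` (`δ₁b = δ₂b'`) with IRREDUCIBLE characteristic polynomial: `disc := (α − γ)² + 4bb'` a non-square.  Put `det' := αγ − bb'` and
`Δ := δ₁²b² − δ₁δ₂αγ = −δ₁δ₂·det'` (`≠ 0`).  File I (★ `…BlockRootPlaneSums`) is the case `γ = −α`.  This file proves, by the same line decomposition: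
* §1 `sum_ite_value_eq_zero'` (the `T`-isotropic vectors: lines `(1,0)`, `(−δ₂γ, 2δ₁b)` if `α = 0`; `(u − δ₁b, δ₁α)`, `u² = Δ`, if `α ≠ 0`), (I1′) `#{w ≠ 0 : T(w) = 0} =
  (q − 1)·(1 + χ(δ₁δ₂(bb' − αγ)))`, (I2′) `Σ_{w ≠ 0, T(w) = 0} χ(m·n(w)) = 0` (the two `T`-isotropic lines have `n₊n₋ = disc·□`);
* §2 (I4′) `Σ_{w ≠ 0} χ(c₀T(w)) = 0` and THE ELLIPTIC TERM (I5′) `Σ_{w ≠ 0} χ(c₀T(w))·χ(−δ₀⁻¹n(w)) = (q − 1)·χ(2c₀δ₀δ₁δ₂)·J(α + γ, disc)`,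
  `J(τ, D) := Σ_v χ(v + τ)χ(v² − D)`, by the affine transfer ★ `ConicTransfer.quadraticChar_quartic_transfer_affine`.
HONEST LABEL: HC_CM is proved only modulo the 2 remaining named inputs (hLiu418 24832, h413 24833) until rung 0 closes; finite-field algebra only, nothing printed is asserted.

## References
* [Rogawski1990] J. D. Rogawski, *Automorphic Representations of Unitary Groups in Three Variables*, Ann. of Math. Stud. 123 (1990), §4.9 Prop. 4.9.1 p. 55.
* [Kottwitz1986] R. E. Kottwitz, *Base change for unit elements of Hecke algebras*, Compositio Math. 60 (1986), §3.
* [LidlNiederreiter1996] R. Lidl, H. Niederreiter, *Finite Fields*, 2nd ed. (1996), Thm. 5.48, Def. 5.49, Thm. 6.26–6.27.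
* [IrelandRosen1990] K. Ireland, M. Rosen, *A Classical Introduction to Modern Number Theory*, GTM 84, Ch. 8 §1–§3, Ch. 18 §2.
-/

set_option autoImplicit false

namespace Literature.NumberTheory.Rogawski1990.TypeTwoBlockRoot

open Finset
open Literature.FieldTheory.FiniteFields.ConicTransfer Literature.FieldTheory.FiniteFields.JacobsthalSums

variable {k : Type*} [Field k] [Fintype k] [DecidableEq k]

/-! ## §1 The `T`-isotropic vectors of the root plane (general block) -/

omit [Fintype k] [DecidableEq k] in
/-- The cone value `T(X,Y) = δ₁αX² + 2δ₁bXY + δ₂γY²` of a general block is a binary quadratic form: `T(t·w) = t²·T(w)`. [cite: LidlNiederreiter1996, Ch. 6 §2] -/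
theorem value_smul' (δ₁ δ₂ α γ b t : k) (w : k × k) :
    δ₁ * α * (t * w.1) ^ 2 + 2 * δ₁ * b * (t * w.1) * (t * w.2) + δ₂ * γ * (t * w.2) ^ 2 =
      t ^ 2 * (δ₁ * α * w.1 ^ 2 + 2 * δ₁ * b * w.1 * w.2 + δ₂ * γ * w.2 ^ 2) := by
  ring

/-- IRREDUCIBILITY BOOKKEEPING (general block): `disc = (α − γ)² + 4bb' ≠ 0`; `α = 0 → b ≠ 0`; `Δ := δ₁²b² − δ₁δ₂αγ = δ₁δ₂(bb' − αγ)`; `bb' − αγ ≠ 0` (else `disc = (α + γ)²`);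
`Δ ≠ 0` (`δ₁b = δ₂b'`, `χ(disc) = −1`). [cite: Rogawski1990, §4.9 Prop. 4.9.1 p. 55] [cite: IrelandRosen1990, Ch. 8 §1] -/
theorem irreducible_bookkeeping' {δ₁ δ₂ : k} (hδ₁ : δ₁ ≠ 0) (hδ₂ : δ₂ ≠ 0) {α γ b b' : k} (hbb : δ₁ * b = δ₂ * b')
    (hirr : quadraticChar k ((α - γ) ^ 2 + 4 * (b * b')) = -1) :
    (α - γ) ^ 2 + 4 * (b * b') ≠ 0 ∧ (α = 0 → b ≠ 0) ∧ δ₁ ^ 2 * b ^ 2 - δ₁ * δ₂ * α * γ = δ₁ * δ₂ * (b * b' - α * γ) ∧ b * b' - α * γ ≠ 0 ∧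
      δ₁ ^ 2 * b ^ 2 - δ₁ * δ₂ * α * γ ≠ 0 := by
  have hnsq : ∀ z : k, quadraticChar k (z ^ 2) ≠ -1 := fun z h => by
    by_cases hz : z = 0
    · rw [hz, zero_pow two_ne_zero, MulChar.map_zero] at h; exact absurd h (by decide)
    · rw [quadraticChar_sq_one' hz] at h; exact absurd h (by decide)
  have hD : (α - γ) ^ 2 + 4 * (b * b') ≠ 0 := fun h => by rw [h, MulChar.map_zero] at hirr; exact absurd hirr (by decide)
  have hΔ : δ₁ ^ 2 * b ^ 2 - δ₁ * δ₂ * α * γ = δ₁ * δ₂ * (b * b' - α * γ) := by linear_combination (δ₁ * b) * hbb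
  have hdet : b * b' - α * γ ≠ 0 := fun h => by
    have h' : (α - γ) ^ 2 + 4 * (b * b') = (α + γ) ^ 2 := by linear_combination 4 * h
    rw [h'] at hirr
    exact hnsq _ hirr
  refine ⟨hD, fun ha hb => ?_, hΔ, hdet, by rw [hΔ]; exact mul_ne_zero (mul_ne_zero hδ₁ hδ₂) hdet⟩
  rw [ha, hb, zero_mul, mul_zero, add_zero, zero_sub, neg_sq] at hirr
  exact hnsq _ hirr

/-- **THE `T`-ISOTROPIC VECTORS (general block).**  For `G` constant on punctured lines: `Σ_{w ≠ 0} [T(w) = 0]·G(w) = (q − 1)·(G(1,0) + G(−δ₂γ, 2δ₁b))` if `α = 0` (the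
lines `(1,0)` and `2δ₁bx + δ₂γ = 0`; `b ≠ 0`), and `= (q − 1)·Σ_{u : u² = Δ} G(u − δ₁b, δ₁α)` if `α ≠ 0`, `Δ = δ₁²b² − δ₁δ₂αγ` — completing the square
`(δ₁(αx + b))² − Δ = δ₁α·T(x,1)`. [cite: LidlNiederreiter1996, Thm. 6.26–6.27] [cite: Kottwitz1986, §3] -/
theorem sum_ite_value_eq_zero' (hk : ringChar k ≠ 2) {δ₁ : k} (hδ₁ : δ₁ ≠ 0) (δ₂ : k) {α b : k} (hab : α ≠ 0 ∨ b ≠ 0) (γ : k)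
    (G : k × k → ℤ) (hG : ∀ (t : k) (w : k × k), t ≠ 0 → G (t * w.1, t * w.2) = G w) :
    ∑ w ∈ univ.filter (fun w : k × k => w ≠ 0), (if δ₁ * α * w.1 ^ 2 + 2 * δ₁ * b * w.1 * w.2 + δ₂ * γ * w.2 ^ 2 = 0 then G w else 0) =
      (Fintype.card k - 1) * (if α = 0 then G (1, 0) + G (-(δ₂ * γ), 2 * δ₁ * b) else
        ∑ u ∈ univ.filter (fun u : k => u ^ 2 = δ₁ ^ 2 * b ^ 2 - δ₁ * δ₂ * α * γ), G (u - δ₁ * b, δ₁ * α)) := by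
  have hinv : ∀ (t : k) (w : k × k), t ≠ 0 →
      (fun w : k × k => if δ₁ * α * w.1 ^ 2 + 2 * δ₁ * b * w.1 * w.2 + δ₂ * γ * w.2 ^ 2 = 0 then G w else 0) (t * w.1, t * w.2) =
        (fun w : k × k => if δ₁ * α * w.1 ^ 2 + 2 * δ₁ * b * w.1 * w.2 + δ₂ * γ * w.2 ^ 2 = 0 then G w else 0) w := by
    intro t w ht
    have ht2 : t ^ 2 ≠ 0 := pow_ne_zero 2 ht
    simp only [value_smul', hG t w ht, mul_eq_zero, ht2, false_or]
  rw [sum_filter_ne_zero_eq_lines _ hinv]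
  congr 1
  simp only [one_pow, mul_one, mul_zero, zero_pow two_ne_zero, add_zero]
  by_cases ha : α = 0
  · have hb : b ≠ 0 := hab.resolve_left (not_not.2 ha)
    have h2b : 2 * δ₁ * b ≠ 0 := mul_ne_zero (mul_ne_zero (Ring.two_ne_zero hk) hδ₁) hb
    rw [if_pos ha, ha, if_pos (mul_zero δ₁)]
    congr 1
    have hx : ∀ x : k, (δ₁ * 0 * x ^ 2 + 2 * δ₁ * b * x + δ₂ * γ = 0) ↔ x = -(δ₂ * γ) / (2 * δ₁ * b) := fun x => by
      rw [eq_div_iff h2b]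
      constructor
      · intro h; linear_combination h
      · intro h; linear_combination h
    simp_rw [hx, Finset.sum_ite_eq' univ (-(δ₂ * γ) / (2 * δ₁ * b)) (fun x => G (x, 1)), if_pos (Finset.mem_univ _)]
    have h := hG (2 * δ₁ * b) (-(δ₂ * γ) / (2 * δ₁ * b), 1) h2b
    simp only [mul_one] at h
    rw [show 2 * δ₁ * b * (-(δ₂ * γ) / (2 * δ₁ * b)) = -(δ₂ * γ) by rw [mul_comm]; exact div_mul_cancel₀ _ h2b] at h
    exact h.symm
  · have hδa : δ₁ * α ≠ 0 := mul_ne_zero hδ₁ ha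
    rw [if_neg ha, if_neg hδa, zero_add]
    have hiff : ∀ x : k, δ₁ * α * x ^ 2 + 2 * δ₁ * b * x + δ₂ * γ = 0 ↔ (δ₁ * α * x + δ₁ * b) ^ 2 = δ₁ ^ 2 * b ^ 2 - δ₁ * δ₂ * α * γ := fun x => by
      constructor
      · intro h; linear_combination (δ₁ * α) * h
      · intro h
        have h' : δ₁ * α * (δ₁ * α * x ^ 2 + 2 * δ₁ * b * x + δ₂ * γ) = 0 := by linear_combination h
        exact (mul_eq_zero.1 h').resolve_left hδa
    have hGx : ∀ x : k, G (x, 1) = G (δ₁ * α * x + δ₁ * b - δ₁ * b, δ₁ * α) := fun x => by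
      have h := hG (δ₁ * α) (x, 1) hδa
      simp only [mul_one] at h
      rw [show δ₁ * α * x + δ₁ * b - δ₁ * b = δ₁ * α * x by ring]
      exact h.symm
    have hbij := affine_bijective hδa (δ₁ * b)
    calc ∑ x : k, (if δ₁ * α * x ^ 2 + 2 * δ₁ * b * x + δ₂ * γ = 0 then G (x, 1) else 0)
        = ∑ x : k, (fun u : k => if u ^ 2 = δ₁ ^ 2 * b ^ 2 - δ₁ * δ₂ * α * γ then G (u - δ₁ * b, δ₁ * α) else 0) (δ₁ * α * x + δ₁ * b) := by
          refine Finset.sum_congr rfl fun x _ => ?_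
          rw [hGx x]
          exact if_congr (hiff x) rfl rfl
      _ = ∑ u : k, (if u ^ 2 = δ₁ ^ 2 * b ^ 2 - δ₁ * δ₂ * α * γ then G (u - δ₁ * b, δ₁ * α) else 0) :=
          hbij.sum_comp (fun u : k => if u ^ 2 = δ₁ ^ 2 * b ^ 2 - δ₁ * δ₂ * α * γ then G (u - δ₁ * b, δ₁ * α) else 0)
      _ = _ := by rw [← Finset.sum_filter]

/-- (I1′) **THE NUMBER OF `T`-ISOTROPIC VECTORS (general block): `#{w ≠ 0 : T(w) = 0} = (q − 1)·(1 + χ(δ₁δ₂(bb' − αγ)))`** = `(q − 1)(1 + χ(Δ))`, `Δ = −δ₁δ₂·det'`.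
[cite: LidlNiederreiter1996, Thm. 6.26–6.27] [cite: Kottwitz1986, §3] -/
theorem sum_ite_value_eq_zero_one' (hk : ringChar k ≠ 2) {δ₁ δ₂ : k} (hδ₁ : δ₁ ≠ 0) (hδ₂ : δ₂ ≠ 0) {α γ b b' : k} (hbb : δ₁ * b = δ₂ * b')
    (hirr : quadraticChar k ((α - γ) ^ 2 + 4 * (b * b')) = -1) :
    ∑ w ∈ univ.filter (fun w : k × k => w ≠ 0), (if δ₁ * α * w.1 ^ 2 + 2 * δ₁ * b * w.1 * w.2 + δ₂ * γ * w.2 ^ 2 = 0 then (1 : ℤ) else 0) =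
      (Fintype.card k - 1) * (1 + quadraticChar k (δ₁ * δ₂ * (b * b' - α * γ))) := by
  obtain ⟨-, ha0, hΔ, -, -⟩ := irreducible_bookkeeping' hδ₁ hδ₂ hbb hirr
  have hab : α ≠ 0 ∨ b ≠ 0 := by
    by_cases ha : α = 0
    · exact Or.inr (ha0 ha)
    · exact Or.inl ha
  rw [sum_ite_value_eq_zero' hk hδ₁ δ₂ hab γ (fun _ => (1 : ℤ)) (fun _ _ _ => rfl)]
  congr 1
  by_cases ha : α = 0
  · have hb : b ≠ 0 := ha0 ha
    have hsq : δ₁ * δ₂ * (b * b' - α * γ) = (δ₁ * b) ^ 2 := by rw [ha]; linear_combination (-(δ₁ * b)) * hbb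
    rw [if_pos ha, hsq, quadraticChar_sq_one' (mul_ne_zero hδ₁ hb)]
  · rw [if_neg ha, Finset.sum_const, nsmul_eq_mul, mul_one, card_filter_sq_eq hk, hΔ]

/-- (I2′) **THE NORM CHARACTERS OF THE `T`-ISOTROPIC VECTORS CANCEL (general block): `Σ_{w ≠ 0, T(w) = 0} χ(m·n(w)) = 0`** (`m ≠ 0`): if `α = 0` the isotropic lines
`(1,0)`, `(−δ₂γ, 2δ₁b)` have `n(1,0)·n(−δ₂γ, 2δ₁b) = disc·(δ₁δ₂)²`; if `α ≠ 0` and `Δ = r²` the lines `(±r − δ₁b, δ₁α)` have `n₊n₋ = disc·(δ₁²δ₂α)²` — a NON-square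
times a square either way. [cite: Rogawski1990, §4.9 Prop. 4.9.1 p. 55] [cite: Kottwitz1986, §3] [cite: LidlNiederreiter1996, Thm. 6.26–6.27] -/
theorem sum_ite_value_eq_zero_quadraticChar_norm' (hk : ringChar k ≠ 2) {δ₁ δ₂ : k} (hδ₁ : δ₁ ≠ 0) (hδ₂ : δ₂ ≠ 0) {α γ b b' : k} (hbb : δ₁ * b = δ₂ * b')
    (hirr : quadraticChar k ((α - γ) ^ 2 + 4 * (b * b')) = -1) {m : k} (hm : m ≠ 0) :
    ∑ w ∈ univ.filter (fun w : k × k => w ≠ 0),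
      (if δ₁ * α * w.1 ^ 2 + 2 * δ₁ * b * w.1 * w.2 + δ₂ * γ * w.2 ^ 2 = 0 then quadraticChar k (m * (δ₁ * w.1 ^ 2 + δ₂ * w.2 ^ 2)) else 0) = 0 := by
  obtain ⟨-, ha0, -, -, hΔ0⟩ := irreducible_bookkeeping' hδ₁ hδ₂ hbb hirr
  have hab : α ≠ 0 ∨ b ≠ 0 := by
    by_cases ha : α = 0
    · exact Or.inr (ha0 ha)
    · exact Or.inl ha
  rw [sum_ite_value_eq_zero' hk hδ₁ δ₂ hab γ (fun w => quadraticChar k (m * (δ₁ * w.1 ^ 2 + δ₂ * w.2 ^ 2))) (fun t w ht => by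
    simp only [norm_smul]; exact quadraticChar_mul_sq_mul m _ ht)]
  refine mul_eq_zero_of_right _ ?_
  by_cases ha : α = 0
  · rw [if_pos ha]
    rw [ha, zero_sub, neg_sq] at hirr
    have hz : m * δ₁ * δ₂ ≠ 0 := mul_ne_zero (mul_ne_zero hm hδ₁) hδ₂
    have hprod : m * (δ₁ * (1 : k) ^ 2 + δ₂ * (0 : k) ^ 2) * (m * (δ₁ * (-(δ₂ * γ)) ^ 2 + δ₂ * (2 * δ₁ * b) ^ 2)) =
        (γ ^ 2 + 4 * (b * b')) * (m * δ₁ * δ₂) ^ 2 := by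
      linear_combination (4 * m ^ 2 * δ₁ ^ 2 * δ₂ * b) * hbb
    have key : quadraticChar k (m * (δ₁ * (1 : k) ^ 2 + δ₂ * (0 : k) ^ 2)) * quadraticChar k (m * (δ₁ * (-(δ₂ * γ)) ^ 2 + δ₂ * (2 * δ₁ * b) ^ 2)) = -1 := by
      rw [← map_mul, hprod, map_mul, hirr, quadraticChar_sq_one' hz, mul_one]
    exact quadraticChar_add_eq_zero_of_mul_eq_neg_one key
  · rw [if_neg ha]
    rcases quadraticChar_dichotomy hΔ0 with h1 | h1
    · obtain ⟨r, hr⟩ := (quadraticChar_one_iff_isSquare hΔ0).1 h1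
      have hr2 : δ₁ ^ 2 * b ^ 2 - δ₁ * δ₂ * α * γ = r ^ 2 := by rw [hr, pow_two]
      have hr0 : r ≠ 0 := fun h0 => hΔ0 (by rw [hr, h0, mul_zero])
      simp_rw [hr2]
      rw [filter_sq_eq_sq r, Finset.sum_pair (ne_neg_self_of_ne_zero hk hr0)]
      have hz : δ₁ ^ 2 * δ₂ * α * m ≠ 0 := mul_ne_zero (mul_ne_zero (mul_ne_zero (pow_ne_zero 2 hδ₁) hδ₂) ha) hm
      have hprod : m * (δ₁ * (r - δ₁ * b) ^ 2 + δ₂ * (δ₁ * α) ^ 2) * (m * (δ₁ * (-r - δ₁ * b) ^ 2 + δ₂ * (δ₁ * α) ^ 2)) =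
          ((α - γ) ^ 2 + 4 * (b * b')) * (δ₁ ^ 2 * δ₂ * α * m) ^ 2 := by
        linear_combination (m ^ 2 * (δ₁ ^ 2 * (r ^ 2 + (δ₁ ^ 2 * b ^ 2 - δ₁ * δ₂ * α * γ)) - 2 * δ₁ ^ 4 * b ^ 2 + 2 * δ₁ ^ 3 * δ₂ * α ^ 2)) * hr2.symm +
          (4 * δ₁ ^ 4 * δ₂ * α ^ 2 * b * m ^ 2) * hbb
      have key : quadraticChar k (m * (δ₁ * (r - δ₁ * b) ^ 2 + δ₂ * (δ₁ * α) ^ 2)) * quadraticChar k (m * (δ₁ * (-r - δ₁ * b) ^ 2 + δ₂ * (δ₁ * α) ^ 2)) = -1 := by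
        rw [← map_mul, hprod, map_mul, hirr, quadraticChar_sq_one' hz, mul_one]
      exact quadraticChar_add_eq_zero_of_mul_eq_neg_one key
    · rw [filter_sq_eq_empty_of_quadraticChar_eq_neg_one h1, Finset.sum_empty]

/-! ## §2 The character sums of the general value form over the whole plane -/

/-- (I4′) **`Σ_{w ≠ 0} χ(c₀·T(w)) = 0`** for the non-degenerate general value form: on the lines `(x,1)`, `T(x,1) = ((δ₁(αx + b))² − Δ)∕(δ₁α)` (`α ≠ 0`, `Δ ≠ 0`:
`Σ_u χ(u² − Δ) = −1` cancels the line `(1,0)`), resp. `T(x,1) = 2δ₁bx + δ₂γ` affine (`α = 0`: `Σ_u χ(u) = 0`). [cite: LidlNiederreiter1996, Thm. 5.48] [cite: IrelandRosen1990, Ch. 8 §2] -/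
theorem sum_quadraticChar_value_eq_zero' (hk : ringChar k ≠ 2) {δ₁ δ₂ : k} (hδ₁ : δ₁ ≠ 0) (hδ₂ : δ₂ ≠ 0) {α γ b b' : k} (hbb : δ₁ * b = δ₂ * b')
    (hirr : quadraticChar k ((α - γ) ^ 2 + 4 * (b * b')) = -1) (c₀ : k) :
    ∑ w ∈ univ.filter (fun w : k × k => w ≠ 0), quadraticChar k (c₀ * (δ₁ * α * w.1 ^ 2 + 2 * δ₁ * b * w.1 * w.2 + δ₂ * γ * w.2 ^ 2)) = 0 := by
  by_cases hc : c₀ = 0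
  · simp [hc]
  obtain ⟨-, ha0, -, -, hΔ0⟩ := irreducible_bookkeeping' hδ₁ hδ₂ hbb hirr
  rw [sum_filter_ne_zero_eq_lines (fun w : k × k => quadraticChar k (c₀ * (δ₁ * α * w.1 ^ 2 + 2 * δ₁ * b * w.1 * w.2 + δ₂ * γ * w.2 ^ 2)))
    (fun t w ht => by simp only [value_smul']; exact quadraticChar_mul_sq_mul c₀ _ ht)]
  refine mul_eq_zero_of_right _ ?_
  simp only [one_pow, mul_one, mul_zero, zero_pow two_ne_zero, add_zero]
  by_cases ha : α = 0
  · have hb : b ≠ 0 := ha0 ha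
    have h2b : c₀ * (2 * δ₁ * b) ≠ 0 := mul_ne_zero hc (mul_ne_zero (mul_ne_zero (Ring.two_ne_zero hk) hδ₁) hb)
    rw [ha]
    simp only [mul_zero, zero_mul, zero_add, MulChar.map_zero]
    have hx : ∀ x : k, quadraticChar k (c₀ * (2 * δ₁ * b * x + δ₂ * γ)) =
        quadraticChar k (c₀ * (2 * δ₁ * b) * x + c₀ * (δ₂ * γ)) := fun x => by
      congr 1; ring
    simp_rw [hx]
    rw [(affine_bijective h2b (c₀ * (δ₂ * γ))).sum_comp (fun u : k => quadraticChar k u), quadraticChar_sum_zero hk]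
  · have hδa : δ₁ * α ≠ 0 := mul_ne_zero hδ₁ ha
    have hx : ∀ x : k, quadraticChar k (c₀ * (δ₁ * α * x ^ 2 + 2 * δ₁ * b * x + δ₂ * γ)) =
        quadraticChar k (c₀ * (δ₁ * α)) * quadraticChar k ((δ₁ * α * x + δ₁ * b) ^ 2 + -(δ₁ ^ 2 * b ^ 2 - δ₁ * δ₂ * α * γ)) := fun x => by
      rw [← map_mul, show c₀ * (δ₁ * α * x ^ 2 + 2 * δ₁ * b * x + δ₂ * γ) =
        c₀ * (δ₁ * α) * ((δ₁ * α * x + δ₁ * b) ^ 2 + -(δ₁ ^ 2 * b ^ 2 - δ₁ * δ₂ * α * γ)) * (δ₁ * α)⁻¹ ^ 2 by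
          calc c₀ * (δ₁ * α * x ^ 2 + 2 * δ₁ * b * x + δ₂ * γ)
              = c₀ * (δ₁ * α * x ^ 2 + 2 * δ₁ * b * x + δ₂ * γ) * ((δ₁ * α) * (δ₁ * α)⁻¹) ^ 2 := by
                rw [mul_inv_cancel₀ hδa, one_pow, mul_one]
            _ = c₀ * (δ₁ * α) * ((δ₁ * α * x + δ₁ * b) ^ 2 + -(δ₁ ^ 2 * b ^ 2 - δ₁ * δ₂ * α * γ)) * (δ₁ * α)⁻¹ ^ 2 := by ring,
        map_mul, map_pow, quadraticChar_sq_one (inv_ne_zero hδa), mul_one]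
    have hI : ∑ u : k, quadraticChar k (u ^ 2 + -(δ₁ ^ 2 * b ^ 2 - δ₁ * δ₂ * α * γ)) = -1 := companionSum_two hk (neg_ne_zero.2 hΔ0)
    simp_rw [hx]
    rw [← Finset.mul_sum, (affine_bijective hδa (δ₁ * b)).sum_comp (fun u : k => quadraticChar k (u ^ 2 + -(δ₁ ^ 2 * b ^ 2 - δ₁ * δ₂ * α * γ))), hI]
    ring

/-- (I5′) **THE ELLIPTIC TERM: `Σ_{w ≠ 0} χ(c₀·T(w))·χ(−δ₀⁻¹·n(w)) = (q − 1)·χ(2c₀δ₀δ₁δ₂)·J(α + γ, disc)`**, `J(τ, D) = Σ_v χ(v + τ)χ(v² − D)`, `disc = (α − γ)² + 4bb'`.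
On the lines the summand is `χ(c₀δ₁)χ(−δ₀⁻¹δ₁)·χ((x² + d)(αx² + 2dyx + γd))`, `d = δ₂∕δ₁`, `y = b'` (`χ(α)` on `(1,0)`), and the affine transfer ★
`ConicTransfer.quadraticChar_quartic_transfer_affine` evaluates `χ(α) + Σ_x …` as `χ(−2d)·J(α + γ, (α − γ)² + 4dy²)`, `4dy² = 4bb'`.
[cite: Rogawski1990, §4.9 Prop. 4.9.1 p. 55] [cite: LidlNiederreiter1996, Def. 5.49, Thm. 6.26–6.27] [cite: IrelandRosen1990, Ch. 18 §2] -/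
theorem sum_quadraticChar_value_mul_quadraticChar_norm' (hk : ringChar k ≠ 2) {δ₀ δ₁ δ₂ : k} (hδ₀ : δ₀ ≠ 0) (hδ₁ : δ₁ ≠ 0) (hδ₂ : δ₂ ≠ 0) {α γ b b' : k}
    (hbb : δ₁ * b = δ₂ * b') (hirr : quadraticChar k ((α - γ) ^ 2 + 4 * (b * b')) = -1) (c₀ : k) :
    ∑ w ∈ univ.filter (fun w : k × k => w ≠ 0),
      quadraticChar k (c₀ * (δ₁ * α * w.1 ^ 2 + 2 * δ₁ * b * w.1 * w.2 + δ₂ * γ * w.2 ^ 2)) * quadraticChar k (-δ₀⁻¹ * (δ₁ * w.1 ^ 2 + δ₂ * w.2 ^ 2)) =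
      (Fintype.card k - 1) * (quadraticChar k (2 * c₀ * δ₀ * δ₁ * δ₂) *
        ∑ v : k, quadraticChar k (v + (α + γ)) * quadraticChar k (v ^ 2 - ((α - γ) ^ 2 + 4 * (b * b')))) := by
  obtain ⟨hD, -, -, -, -⟩ := irreducible_bookkeeping' hδ₁ hδ₂ hbb hirr
  rw [sum_filter_ne_zero_eq_lines (fun w : k × k => quadraticChar k (c₀ * (δ₁ * α * w.1 ^ 2 + 2 * δ₁ * b * w.1 * w.2 + δ₂ * γ * w.2 ^ 2)) *
      quadraticChar k (-δ₀⁻¹ * (δ₁ * w.1 ^ 2 + δ₂ * w.2 ^ 2))) (fun t w ht => by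
    simp only [value_smul', norm_smul, quadraticChar_mul_sq_mul c₀ _ ht, quadraticChar_mul_sq_mul (-δ₀⁻¹) _ ht])]
  congr 1
  simp only [one_pow, mul_one, mul_zero, zero_pow two_ne_zero, add_zero]
  have hd : δ₂ / δ₁ ≠ 0 := div_ne_zero hδ₂ hδ₁
  have hb : b = δ₂ * b' / δ₁ := by rw [eq_div_iff hδ₁]; linear_combination hbb
  have hdy : 4 * (δ₂ / δ₁) * b' ^ 2 = 4 * (b * b') := by rw [hb]; ring
  have hD' : (α - γ) ^ 2 + 4 * (δ₂ / δ₁) * b' ^ 2 ≠ 0 := by rw [hdy]; exact hD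
  have h10 : quadraticChar k (c₀ * (δ₁ * α)) * quadraticChar k (-δ₀⁻¹ * δ₁) = quadraticChar k (c₀ * δ₁ * (-δ₀⁻¹ * δ₁)) * quadraticChar k α := by
    rw [← map_mul, ← map_mul]; congr 1; ring
  have hx : ∀ x : k, quadraticChar k (c₀ * (δ₁ * α * x ^ 2 + 2 * δ₁ * b * x + δ₂ * γ)) * quadraticChar k (-δ₀⁻¹ * (δ₁ * x ^ 2 + δ₂)) =
      quadraticChar k (c₀ * δ₁ * (-δ₀⁻¹ * δ₁)) *
        quadraticChar k ((x ^ 2 + δ₂ / δ₁) * (α * x ^ 2 + 2 * (δ₂ / δ₁) * b' * x + γ * (δ₂ / δ₁))) := fun x => by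
    rw [← map_mul, ← map_mul]; congr 1; rw [hb]; field_simp
  rw [h10]
  simp_rw [hx]
  rw [← Finset.mul_sum, ← mul_add, quadraticChar_quartic_transfer_affine hk hd α γ b' hD', ← mul_assoc, ← map_mul, hdy]
  congr 1
  rw [show c₀ * δ₁ * (-δ₀⁻¹ * δ₁) * (-2 * (δ₂ / δ₁)) = 2 * c₀ * δ₀ * δ₁ * δ₂ * δ₀⁻¹ ^ 2 by field_simp, map_mul, map_pow,
    quadraticChar_sq_one (inv_ne_zero hδ₀), mul_one]

end Literature.NumberTheory.Rogawski1990.TypeTwoBlockRoot
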